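import Summits.QuantumFields.BalabanUV.T4Continuum.Spine.NE7cSmoothing

/-!
# T⁴ programme, spine node NE7c (U5b) — ROAD P3 «SMOOTHING», NON-VACUITY OF END-W ON A CONCRETE GAUGE-FIELD FAMILY

Cell `pub-balaban`, row NE7c co-owner #3 (unit `b2b-balaban-t4-ne7c-p3`), skeleton `HOME/t4/skeletons/NE7c-t4-ne7c-p3.md` offer
(x4) ∕ referee checklist (g).  A TOY — NOT Bałaban's terms, no print involved: on the concrete four-torus family
`T4WindowLevelShift.Sanity.F13` (`L = 13`, `m = 1`) with structure group `SU(2)`, ONE older history per cutoff (`ι₀ = Unit`),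
window depth `N_W = 0`, ONE declared young letter of age `0` per history (so the η-LAYER `T4PatternLayer.layerT₂` has the TWO
terms `((), ∅)` (small polarity) and `((), {0})` (large polarity) per cutoff), the piecewise-linear profile of width `1/2`
(`T4LipschitzLedger.Sanity.χ`, Lipschitz constant `2`), threshold `1`, older weights `≡ 1`, and CONSTANT window functionals:
run A tests `3/4` (inside the transition layer), run B tests `3/4 + (1/2)^K/8`.  THEN every binder of END-W
(`NE7cSmoothing.shellWeightBound_patterned`) is inhabited on the product Haar spaces `fieldMeasure (F13.P K) 0 (SU 2)` and the
END FIRES (`toy_shellWeightBound`): the literal `T4IndicatorShell.ShellWeightBound` for the layered families with band weight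
`K ↦ Σ_{a<1} 1 · lipWeight Lχ 2 ρ a K = (1/2)^K / 2` (`toy_bandWeight`; `ρ_j = (1/2)^j/8` summable), with sibling suppression
`2` DISCHARGED by the flip involution — and the model is NON-DEGENERATE: the two runs DIFFER at every cutoff and run A's realized
shell part of the small-polarity term is `(1/2)^K/4 > 0` (`toy_shellW`, `toy_shellW_pos`), computed THROUGH the old-transport
density (`T4FinestToWindow.integral_oldDensity`: the performed old steps have total mass one).  PURPOSE: END-W's binder set is
JOINTLY SATISFIABLE by non-trivial data ON THE CELL'S OWN GAUGE-FIELD SPACES (pv07's `T4LipschitzLedger` §5 toy is the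
Dirac-point analogue for the abstract ledger).  Nothing here is an estimate; nothing of Bałaban's is asserted; no definition is
introduced (the toy data are written as literal lambda terms).  [folklore] bookkeeping; NOT summit progress; spine 0/9 unchanged;
rung (B)+1 ≠ infinite volume ∕ mass gap ∕ Clay.
-/

noncomputable section

open MeasureTheory Finset Filter Topology
open scoped NNReal ENNReal

namespace Summit.QuantumFields.BalabanUV.T4Continuum.NE7cSmoothing.Toy

open Literature.MathematicalPhysics.QuantumFieldTheory.Balaban1983to89
open T4Continuum T4LevelShift T4AveragingDisintegration T4WindowLevelShift T4LipschitzLedger T4FiniteEpsInhabited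
  BlockAveraging ExpMeanLog T4FinestToWindow T4AgeZeroLayer T4PatternLayer
open T4IndicatorShell T4LipschitzCutoff
open T4WindowLevelShift.Sanity (F13)
open T4LipschitzLedger.Sanity (χ κ Lχ profiles ρ summable_ρ half_pow_pos half_pow_le_one profile_A profile_B)

/-- the (F∞) width is nonnegative. [folklore] -/
theorem ρ_nonneg (j : ℕ) : 0 ≤ ρ j := by
  simp only [ρ]; positivity

/-- **END-W FIRES ON THE TOY LAYER over `F13`, `SU(2)`.**  Data (literal terms): older histories `T₀ K = {()}`, window depth
`0`, one declared letter per history in slot `⟨0, 0⟩`, `N₀ = 0`, `n ≡ 1`, threshold `1`, fixed polarity irrelevant (`small`),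
window functionals `vA ≡ 3/4`, `vB ≡ 3/4 + (1/2)^K/8`, older weights `RA ≡ RB ≡ 1`. [folklore] -/
theorem toy_shellWeightBound :
    ShellWeightBound 1 (layerT₂ (fun _ : ℕ => ({()} : Finset Unit)) (fun _ _ => 1))
      (layerX₂ (N := 2) F13 χ (fun _ : Unit => 0) (fun _ _ => 1) (fun _ _ => 1) (fun _ _ _ => (⟨0, 0⟩ : Σ _ : ℕ, ℕ))
        (fun _ _ _ => Pol.small) (fun _ _ _ => (1 : ℝ)) (fun _ _ _ _ => (3 / 4 : ℝ)) (fun K => K)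
        (fun _ _ _ _ => (1 : ℝ)))
      (layerX₂ (N := 2) F13 χ (fun _ : Unit => 0) (fun _ _ => 1) (fun _ _ => 1) (fun _ _ _ => (⟨0, 0⟩ : Σ _ : ℕ, ℕ))
        (fun _ _ _ => Pol.small) (fun _ _ _ => (1 : ℝ)) (fun K _ _ _ => (3 / 4 : ℝ) + (1 / 2 : ℝ) ^ K / 8) (fun K => K + 1)
        (fun _ _ _ _ => (1 : ℝ)))
      (shellW χ (fun _ _ => fieldMeasure (F13.P 0) 0 (SU 2)) (layerM₂ (fun _ _ => 1))
        (layerSlot₂ (fun _ _ _ => (⟨0, 0⟩ : Σ _ : ℕ, ℕ))) (layerPol₂ (fun _ _ => 1) (fun _ _ _ => Pol.small))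
        (layerThr (fun _ _ _ => (1 : ℝ))) (layerVar₂ (Ωw := fun _ : Unit => GaugeField (F13.P 0) 0 (SU 2)) (fun _ _ _ _ => (3 / 4 : ℝ)))
        (layerVar₂ (Ωw := fun _ : Unit => GaugeField (F13.P 0) 0 (SU 2)) (fun K _ _ _ => (3 / 4 : ℝ) + (1 / 2 : ℝ) ^ K / 8))
        (fun K t τ V => (oldDensity F13 (expMeanLogSU : LoopAverage (SU 2)) K 0
          (layerRem (fun (K' : ℕ) (_ : ℝ) (_ : Unit) (_ : GaugeField (F13.P K') 0 (SU 2)) => (1 : ℝ)) K t τ) V : ℝ)))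
      (shellW χ (fun _ _ => fieldMeasure (F13.P 0) 0 (SU 2)) (layerM₂ (fun _ _ => 1))
        (layerSlot₂ (fun _ _ _ => (⟨0, 0⟩ : Σ _ : ℕ, ℕ))) (layerPol₂ (fun _ _ => 1) (fun _ _ _ => Pol.small))
        (layerThr (fun _ _ _ => (1 : ℝ))) (layerVar₂ (Ωw := fun _ : Unit => GaugeField (F13.P 0) 0 (SU 2)) (fun K _ _ _ => (3 / 4 : ℝ) + (1 / 2 : ℝ) ^ K / 8))
        (layerVar₂ (Ωw := fun _ : Unit => GaugeField (F13.P 0) 0 (SU 2)) (fun _ _ _ _ => (3 / 4 : ℝ)))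
        (fun K t τ V => (oldDensity F13 (expMeanLogSU : LoopAverage (SU 2)) (K + 1) 0
          (layerRem (fun (K' : ℕ) (_ : ℝ) (_ : Unit) (_ : GaugeField (F13.P (K' + 1)) 0 (SU 2)) => (1 : ℝ)) K t τ) V : ℝ)))
      (fun K => ∑ a ∈ range (0 + 1), (((fun _ : ℕ => (1 : ℕ)) a : ℕ) : ℝ) * lipWeight Lχ (fun _ => 2) ρ a K) := by
  refine shellWeightBound_patterned (N := 2) F13 (T₀ := fun _ : ℕ => ({()} : Finset Unit)) (ρ := ρ) profiles
    (N₀ := 0) (n := fun _ => 1) (NW₀ := fun _ : Unit => 0) ?_ (m₀ := fun _ _ => 1)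
    (slot₀ := fun _ _ _ => (⟨0, 0⟩ : Σ _ : ℕ, ℕ)) ?_ ?_ ?_ (fpol := fun _ _ _ => Pol.small) (θ₀ := fun _ _ _ => (1 : ℝ)) ?_
    (vA := fun _ _ _ _ => (3 / 4 : ℝ)) (vB := fun K _ _ _ => (3 / 4 : ℝ) + (1 / 2 : ℝ) ^ K / 8) ?_ ?_
    (RA := fun _ _ _ _ => (1 : ℝ)) (RB := fun _ _ _ _ => (1 : ℝ)) ?_ ?_ ?_ ?_ ρ_nonneg summable_ρ
  · -- window depth ≤ K
    intro K τ _; exact Nat.zero_le K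
  · -- slots in the window of ages ≤ 0 with < 1 copies
    intro K τ _ i _; simp [Finset.mem_sigma]
  · -- age ≤ K
    intro K τ _ i _; exact Nat.zero_le K
  · -- one factor per slot
    intro K τ _ j hj j' hj' _
    have h1 : j < 1 := hj
    have h2 : j' < 1 := hj'
    omega
  · -- positive thresholds
    intro K τ _ i _; norm_num
  · -- measurable window functionals (constants)
    intro K τ _ i _; exact ⟨measurable_const, measurable_const⟩
  · -- the two-run closeness with width ρ (K − 0) · 1
    intro K τ _ i _
    refine ae_of_all _ fun V => ?_
    simp only [Nat.sub_zero, mul_one, ρ]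
    rw [show (3 / 4 : ℝ) - (3 / 4 + (1 / 2 : ℝ) ^ K / 8) = -((1 / 2 : ℝ) ^ K / 8) by ring, abs_neg,
      abs_of_nonneg (by positivity)]
  · intro K t _ τ _; exact ae_of_all _ fun _ => zero_le_one
  · intro K t _ τ _; exact integrable_const _
  · intro K t _ τ _; exact ae_of_all _ fun _ => zero_le_one
  · intro K t _ τ _; exact integrable_const _

/-- THE BAND WEIGHT of the toy is `(1/2)^K / 2` (`= Lχ·2·ρ_K = 2·2·(1/2)^K/8`): `< 1` at every `K`, summable. [folklore] -/
theorem toy_bandWeight (K : ℕ) :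
    ∑ a ∈ range (0 + 1), (((fun _ : ℕ => (1 : ℕ)) a : ℕ) : ℝ) * lipWeight Lχ (fun _ => 2) ρ a K = (1 / 2 : ℝ) ^ K / 2 := by
  simp only [zero_add, sum_range_one, lipWeight, Nat.zero_le, if_true, Lχ, ρ, Nat.sub_zero]
  ring

/-- NON-DEGENERACY: run A's realized shell part of the small-polarity term `((), ∅)` is `(1/2)^K / 4` at EVERY cutoff —
computed through the old-transport density of the constant older weight (total mass one, `integral_oldDensity`). [folklore] -/
theorem toy_shellW (K : ℕ) (t : ℝ) :
    shellW χ (fun _ _ => fieldMeasure (F13.P 0) 0 (SU 2)) (layerM₂ (fun _ _ => 1))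
        (layerSlot₂ (fun _ _ _ => (⟨0, 0⟩ : Σ _ : ℕ, ℕ))) (layerPol₂ (fun _ _ => 1) (fun _ _ _ => Pol.small))
        (layerThr (fun _ _ _ => (1 : ℝ))) (layerVar₂ (Ωw := fun _ : Unit => GaugeField (F13.P 0) 0 (SU 2)) (fun _ _ _ _ => (3 / 4 : ℝ)))
        (layerVar₂ (Ωw := fun _ : Unit => GaugeField (F13.P 0) 0 (SU 2)) (fun K _ _ _ => (3 / 4 : ℝ) + (1 / 2 : ℝ) ^ K / 8))
        (fun K t τ V => (oldDensity F13 (expMeanLogSU : LoopAverage (SU 2)) K 0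
          (layerRem (fun (K' : ℕ) (_ : ℝ) (_ : Unit) (_ : GaugeField (F13.P K') 0 (SU 2)) => (1 : ℝ)) K t τ) V : ℝ)) K t ((), ∅) = (1 / 2 : ℝ) ^ K / 4 := by
  have hx0 := half_pow_pos K
  have hx1 := half_pow_le_one K
  -- the min-piece of the single factor is the constant (1/2) − ((1/2) − x/4) = x/4
  have hpiece : ∀ V : GaugeField (F13.P 0) 0 (SU 2),
      pieceAt χ (layerSlot₂ (fun _ _ _ => (⟨0, 0⟩ : Σ _ : ℕ, ℕ)) K ((), ∅))
        (layerPol₂ (fun _ _ => 1) (fun _ _ _ => Pol.small) K ((), ∅)) (layerThr (fun _ _ _ => (1 : ℝ)) K ((), ∅))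
        (fun j => layerVar₂ (Ωw := fun _ : Unit => GaugeField (F13.P 0) 0 (SU 2)) (fun _ _ _ _ => (3 / 4 : ℝ)) K ((), (∅ : Finset ℕ)) j V)
        (fun j => layerVar₂ (Ωw := fun _ : Unit => GaugeField (F13.P 0) 0 (SU 2)) (fun K _ _ _ => (3 / 4 : ℝ) + (1 / 2 : ℝ) ^ K / 8) K ((), (∅ : Finset ℕ)) j V) 1 0 =
        (1 / 2 : ℝ) ^ K / 4 := by
    intro V
    have hpol : layerPol₂ (ι₀ := Unit) (fun _ _ => 1) (fun _ _ _ => Pol.small) K ((), ∅) 0 = Pol.small := by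
      simp [layerPol₂, patPol]
    simp only [pieceAt, minPiece, range_zero, prod_empty, one_mul, Finset.Ico_self, mul_one, facAt, hpol,
      Pol.fac_small, χ]
    rw [profile_A, profile_B K, min_eq_right (by linarith)]
    ring
  simp only [shellW, layerM₂, sum_range_one]
  simp_rw [hpiece]
  rw [integral_const_mul]
  have hmass : ∫ V, (oldDensity F13 (expMeanLogSU : LoopAverage (SU 2)) K 0
      (layerRem (fun (K' : ℕ) (_ : ℝ) (_ : Unit) (_ : GaugeField (F13.P K') 0 (SU 2)) => (1 : ℝ)) K t ((), (∅ : Finset ℕ))) V : ℝ)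
      ∂fieldMeasure (F13.P 0) 0 (SU 2) = 1 := by
    rw [integral_oldDensity F13 (Nat.zero_le K) (integrable_const _) (ae_of_all _ fun _ => zero_le_one)]
    simp
  rw [hmass, mul_one]

/-- … hence POSITIVE at every cutoff: the shell parts END-W bounds are not identically zero. [folklore] -/
theorem toy_shellW_pos (K : ℕ) (t : ℝ) :
    0 < shellW χ (fun _ _ => fieldMeasure (F13.P 0) 0 (SU 2)) (layerM₂ (fun _ _ => 1))
        (layerSlot₂ (fun _ _ _ => (⟨0, 0⟩ : Σ _ : ℕ, ℕ))) (layerPol₂ (fun _ _ => 1) (fun _ _ _ => Pol.small))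
        (layerThr (fun _ _ _ => (1 : ℝ))) (layerVar₂ (Ωw := fun _ : Unit => GaugeField (F13.P 0) 0 (SU 2)) (fun _ _ _ _ => (3 / 4 : ℝ)))
        (layerVar₂ (Ωw := fun _ : Unit => GaugeField (F13.P 0) 0 (SU 2)) (fun K _ _ _ => (3 / 4 : ℝ) + (1 / 2 : ℝ) ^ K / 8))
        (fun K t τ V => (oldDensity F13 (expMeanLogSU : LoopAverage (SU 2)) K 0
          (layerRem (fun (K' : ℕ) (_ : ℝ) (_ : Unit) (_ : GaugeField (F13.P K') 0 (SU 2)) => (1 : ℝ)) K t τ) V : ℝ)) K t ((), ∅) := by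
  rw [toy_shellW]; exact div_pos (half_pow_pos K) (by norm_num)

/-- THE TWO RUNS DIFFER: run A's small-polarity term weighs `1/2`, run B's `1/2 − (1/2)^K/4` (constant integrands against
probability measures). [folklore] -/
theorem toy_weights (K : ℕ) (t : ℝ) :
    layerX₂ (N := 2) F13 χ (fun _ : Unit => 0) (fun _ _ => 1) (fun _ _ => 1) (fun _ _ _ => (⟨0, 0⟩ : Σ _ : ℕ, ℕ))
        (fun _ _ _ => Pol.small) (fun _ _ _ => (1 : ℝ)) (fun _ _ _ _ => (3 / 4 : ℝ)) (fun K => K)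
        (fun _ _ _ _ => (1 : ℝ)) K t ((), ∅) = 1 / 2 ∧
      layerX₂ (N := 2) F13 χ (fun _ : Unit => 0) (fun _ _ => 1) (fun _ _ => 1) (fun _ _ _ => (⟨0, 0⟩ : Σ _ : ℕ, ℕ))
        (fun _ _ _ => Pol.small) (fun _ _ _ => (1 : ℝ)) (fun K _ _ _ => (3 / 4 : ℝ) + (1 / 2 : ℝ) ^ K / 8) (fun K => K + 1)
        (fun _ _ _ _ => (1 : ℝ)) K t ((), ∅) = 1 / 2 - (1 / 2 : ℝ) ^ K / 4 := by
  have hpol : layerPol₂ (ι₀ := Unit) (fun _ _ => 1) (fun _ _ _ => Pol.small) K ((), ∅) 0 = Pol.small := by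
    simp [layerPol₂, patPol]
  constructor
  · simp only [layerX₂, prod_range_one, facAt, hpol, Pol.fac_small, χ, mul_one]
    rw [profile_A, integral_const]
    simp
  · simp only [layerX₂, prod_range_one, facAt, hpol, Pol.fac_small, χ, mul_one]
    rw [profile_B K, integral_const]
    simp

end Summit.QuantumFields.BalabanUV.T4Continuum.NE7cSmoothing.Toy

end
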